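import Mathlib.AlgebraicGeometry.SpreadingOut
import Mathlib.AlgebraicGeometry.Morphisms.FiniteType
import HarnessLib

/-!
# Spreading out an isomorphism of stalks to a morphism of a neighbourhood
# (crux `FrobeniusLadder.FRationalResolution`, line `Sketch`)

Stub `exists_nhd_hom_of_stalk_iso` of the skeleton `Sketch` for crux
stmt-ResolutionOfSingularities-15317 (theme REC: Zariski-local recognition). Let `X` and `Y` be
schemes over a field `k`, with `X` integral and `Y → Spec k` locally of finite type, and let
`e : 𝒪_{Y,y} ≅ 𝒪_{X,x}` be an isomorphism of stalks compatible with the structure morphisms. Then the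
`k`-morphism `Spec 𝒪_{X,x} → Spec 𝒪_{Y,y} → Y` spreads out to a `k`-morphism `f : U → Y` of an open
neighbourhood `U ∋ x` (Mathlib's `spread_out_of_isGermInjective'`, Stacks 0BX6; an integral scheme is
germ-injective at every point), and `f x = y`: evaluate the factorisation
`Spec.map e.hom ≫ Y.fromSpecStalk y = U.fromSpecStalkOfMem x _ ≫ f` at the closed point of
`Spec 𝒪_{X,x}`, which `Spec.map e.hom` sends to the closed point of `Spec 𝒪_{Y,y}` (an isomorphism of
local rings is a local homomorphism) and `U.fromSpecStalkOfMem x _` sends to `x`.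
-/

-- single-problem summit: the doubled namespace component `ResolutionOfSingularities` is forced
set_option linter.dupNamespace false

noncomputable section

namespace Summit.ResolutionOfSingularities.ResolutionOfSingularities.Theorems.FRationalResolution

open CategoryTheory AlgebraicGeometry TopologicalSpace IsLocalRing

/-- **Spreading out an isomorphism of stalks** (one direction, with the point and the germ
identified). For `k`-schemes `X`, `Y` with `X` integral and `Y → Spec k` locally of finite type, an
isomorphism of stalks `e : 𝒪_{Y,y} ≅ 𝒪_{X,x}` over `k` is induced on `Spec 𝒪_{X,x}` by a `k`-morphism
`f : U → Y` of an open neighbourhood `U` of `x` with `f x = y`. -/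
theorem exists_nhd_hom_of_stalk_iso (k : Type) [Field k] (X Y : Scheme.{0}) [IsIntegral X]
    (fX : X ⟶ Spec (.of k)) (fY : Y ⟶ Spec (.of k)) [LocallyOfFiniteType fY] (x : X) (y : Y)
    (e : Y.presheaf.stalk y ≅ X.presheaf.stalk x)
    (he : Spec.map e.hom ≫ Y.fromSpecStalk y ≫ fY = X.fromSpecStalk x ≫ fX) :
    ∃ (U : X.Opens) (hxU : x ∈ U) (f : (U : Scheme.{0}) ⟶ Y),
      Spec.map e.hom ≫ Y.fromSpecStalk y = U.fromSpecStalkOfMem x hxU ≫ f ∧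
      f ≫ fY = U.ι ≫ fX ∧ f.base ⟨x, hxU⟩ = y := by
  obtain ⟨U, hxU, f, h₁, h₂⟩ := spread_out_of_isGermInjective' fX fY
    (Spec.map e.hom ≫ Y.fromSpecStalk y) (by simpa only [Category.assoc] using he)
  refine ⟨U, hxU, f, h₁, h₂, ?_⟩
  -- `U.fromSpecStalkOfMem x hxU` sends the closed point of `Spec 𝒪_{X,x}` to `⟨x, hxU⟩`
  have hcl : (U.fromSpecStalkOfMem x hxU).base (closedPoint (X.presheaf.stalk x)) = ⟨x, hxU⟩ := by
    apply U.ι.isOpenEmbedding.injective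
    change (U.fromSpecStalkOfMem x hxU ≫ U.ι).base (closedPoint (X.presheaf.stalk x)) = x
    rw [Scheme.Opens.fromSpecStalkOfMem_ι, Scheme.fromSpecStalk_closedPoint]
  -- an isomorphism of local rings is a local homomorphism
  haveI : IsLocalHom e.hom.hom := isLocalHom_of_iso e
  have key := congrArg (fun g : Spec (X.presheaf.stalk x) ⟶ Y =>
    g.base (closedPoint (X.presheaf.stalk x))) h₁
  simp only [Scheme.Hom.comp_base, TopCat.coe_comp, Function.comp_apply] at key
  rw [hcl] at key
  rw [← key]
  change (Y.fromSpecStalk y).base ((Spec.map e.hom).base (closedPoint (X.presheaf.stalk x))) = y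
  rw [Spec_closedPoint, Scheme.fromSpecStalk_closedPoint]

end Summit.ResolutionOfSingularities.ResolutionOfSingularities.Theorems.FRationalResolution

end
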